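import Mathlib
import Literature.Analysis.FluidPDE.NSViscosityRescaling
import Literature.Analysis.FluidPDE.KNSSTypeIIHolds
import Literature.Analysis.FluidPDE.MollifiedSliceTools
import Literature.Analysis.FluidPDE.NSCriticalClosureBesovBounded
import Literature.Analysis.FluidPDE.TaoLocalisationHolds
import Literature.Analysis.FluidPDE.AncientMildCurlCompactness
import Summits.NavierStokesRegularity.NavierStokesRegularity.Theorems.PlaneEnergyCeilingBoundedPlanarEnergyRegularityZoomLimit
import Summits.NavierStokesRegularity.NavierStokesRegularity.Theorems.PlaneEnergyCeilingBoundedPlanarEnergyRegularityZoomOseenLimit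
import Summits.NavierStokesRegularity.NavierStokesRegularity.Theorems.DSolutionBubbleTypeIISlowDoublingEternalExtraction
import Summits.NavierStokesRegularity.NavierStokesRegularity.Theorems.VorticityPacePaceZoomLimit
import Summits.NavierStokesRegularity.NavierStokesRegularity.Theorems.TypeTwoEternalEternalExtractionCells
import Summits.NavierStokesRegularity.NavierStokesRegularity.Theses.TypeTwoEternal
import HarnessLib

/-!
# `TypeTwoEternal.EternalExtraction` — pace at heavy doubling cells ⇒ a bounded ETERNAL mild
# solution with a non-constant slice (item stmt-NavierStokesRegularity-18163)

**Statement.** `ν > 0`, `T > 0`, `(u, p)` classical on `ℝ³ × [0, T)`, Leray–Hopf on `[0, T]` from a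
rapidly decaying datum, with NO smooth extension past `T` and NOT of Type I; fix `θ₀, K₀ > 0` and
assume PACE AT HEAVY DOUBLING CELLS: whenever `(T', t₀, x₀)` (`0 ≤ t₀ < T' < T`) has weight
`‖u(t₀, x₀)‖ √(T' − t₀) ≥ K₀` and `‖u(t, x)‖ √(T' − t) ≤ 2 ‖u(t₀, x₀)‖ √(T' − t₀)` on
`[0, T'] × ℝ³`, some `x` with `dist(x, x₀) ≤ ν/‖u(t₀, x₀)‖` has `θ₀ ‖u(t₀, x₀)‖² ≤ ν ‖curl u(t₀)(x)‖`.
Then there is `v`, bounded, jointly `C^∞`, with measurable slices, every time-shift of which is an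
ancient mild solution (`ν = 1`) — a bounded ETERNAL mild solution — with a spatially non-constant
slice.

PROOF (KNSS 2009 §6 two-sided zoom).
1. Normalise `ν = 1` (`w(s) = ν⁻¹u(s/ν)`); sub-slab bounds (`exists_forall_norm_le_of_tao2011`);
   slices uniformly in `L²`. The failure of the Type-I rate gives DOUBLING CELLS OF EVERY WEIGHT
   (tools `EternalExtraction.exists_weighted_cell`: factor-2 near-maximisers of the bounded weighted
   size `‖u‖ √(T' − t)` on `[0, T'] × ℝ³` — no point-picking lemma is needed for this global-in-space
   form); heavy weights force `t₀ > T/2` and large `‖u(t₀, x₀)‖`.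
2. The hypothesis supplies, cell by cell, a point `x*_j` with certified vorticity. Zoom CENTRED AT
   `x*_j` with scale `c_j = ν/(√2 M_j)`, `M_j = ‖u(t₀, x₀)‖`: on the two-sided window `(A_j, B_j)`,
   `A_j ≤ −(j+2)`, `B_j ≥ j+2` (physical times up to half the remaining life `(T' + t₀)/2`), the
   cell bound gives `‖V_j‖ ≤ 2`, and `‖curl V_j(0)(0)‖ ≥ θ₀/2`.
3. ETERNAL EXTRACTION (tools of `DSolutionBubble.TypeIISlowDoublingEternal`:
   `TypeIISlowDoublingEternal.exists_eternal_limit`, `eternal_of_oseen`): a subsequence converges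
   pointwise on `ℝ × ℝ³` to a continuous bounded `w_∞` with the Oseen identity for all `s < t`,
   every shift of which is a bounded ancient mild solution, and `w_∞ ∈ C^∞`.
4. NON-CONSTANCY: on the windows shifted by one time unit, KNSS Lemma 6.1 with vorticity
   (`exists_ancientMild_limit_curl_tendsto`) makes the curls converge at the (now interior) apex,
   so `‖curl w_∞(0)(0)‖ ≥ θ₀/2`, and a constant slice has zero curl.

HONEST FRAMING: a compactness lemma about HYPOTHETICAL Type-II blow-up solutions under a
hypothetical pace condition (other route, not a pub-ns-dss cell file); nothing here bears on the
regularity problem itself. The item is proved directly (the registered stubs are bypassed).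
References: Koch–Nadirashvili–Seregin–Šverák 2009, §6 (arXiv:0709.3599). [KochNadirashviliSereginSverak2009]
-/

noncomputable section

set_option linter.dupNamespace false

namespace Summit.NavierStokesRegularity.NavierStokesRegularity.Theorems

open MeasureTheory Set Function Filter Topology TopologicalSpace Metric
open scoped NNReal ENNReal ContDiff
open Literature.Analysis Literature.Analysis.FluidPDE

open TypeIISlowDoublingEternal EternalExtraction PaceZoom in
/-- **`TypeTwoEternal.EternalExtraction`** (item stmt-NavierStokesRegularity-18163, module
docstring): pace at all heavy doubling cells of a non-Type-I blow-up yields a bounded ETERNAL mild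
solution with a spatially non-constant slice. [cite: KochNadirashviliSereginSverak2009, §6 (6.2)–(6.3), Lemma 6.1 (arXiv:0709.3599 pp. 11–12)] -/
theorem typeTwoEternal_eternalExtraction_proof : Theses.TypeTwoEternal.EternalExtraction := by
  intro ν T hν hT u p hcl hLH hdec hne hnotI θ₀ K₀ hθ₀ hK₀ hpace
  have hν' : 0 < ν⁻¹ := inv_pos.2 hν
  have hνT : 0 < ν * T := mul_pos hν hT
  have hu₀2 : MemLp (u 0) 2 volume := hLH.memLp 0 ⟨le_rfl, hT.le⟩
  -- adapted from `BoundedPlanarEnergyRegularity.stub_planarEnergyZoom`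
  -- (Theorems/PlaneEnergyCeilingBoundedPlanarEnergyRegularityStubPlanarEnergyZoom.lean), Steps 1–2
  -- ### Step 1: normalise the viscosity to `1`
  set w : ℝ → EuclideanSpace ℝ (Fin 3) → EuclideanSpace ℝ (Fin 3) := timeRescale ν⁻¹ ν⁻¹ u
    with hwdef
  set q : ℝ → EuclideanSpace ℝ (Fin 3) → ℝ := timeRescale ν⁻¹ (ν⁻¹ ^ 2) p with hqdef
  have hmaps : MapsTo (fun s => ν⁻¹ * s) (Ioo 0 (ν * T)) (Ioo 0 T) := fun s hs =>
    (inv_mul_mem_Ioo_iff hν).2 hs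
  have hclw : IsClassicalNSSolutionOn (Ioo 0 (ν * T)) 1 0 w q := by
    have h1 := (hcl.mono Ioo_subset_Ico_self (uniqueDiffOn_Ioo 0 T)).viscosityRescale_set hν.ne'
      hmaps (uniqueDiffOn_Ioo 0 (ν * T))
    simpa only [timeRescale_zero_force] using h1
  have hw_apply : ∀ s x, w s x = ν⁻¹ • u (ν⁻¹ * s) x := fun s x => rfl
  have hw_norm : ∀ s x, ‖w s x‖ = ν⁻¹ * ‖u (ν⁻¹ * s) x‖ := fun s x => by
    rw [hw_apply, norm_smul, Real.norm_eq_abs, abs_of_pos hν']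
  -- ### Step 2: sub-slab bounds, `L²` slices
  have hbddu : ∀ T' < T, ∃ Mb : ℝ, ∀ t ∈ Icc (0 : ℝ) T', ∀ x, ‖u t x‖ ≤ Mb := by
    intro T' hT'
    rcases lt_or_ge T' 0 with h0 | h0
    · exact ⟨0, fun t ht _ => absurd (ht.1.trans ht.2) (not_le.2 h0)⟩
    · have hT₂ : (T' + T) / 2 ∈ Ioo 0 T := ⟨by linarith, by linarith⟩
      obtain ⟨M₁, hM₁⟩ := exists_forall_norm_le_of_tao2011 tao2011_hasBoundedSobolevNormsOn_holds hν
        hcl hLH hdec _ hT₂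
      exact ⟨M₁, fun t ht x => hM₁ t ⟨ht.1, by linarith [ht.2]⟩ x⟩
  have hmem_u : ∀ s ∈ Ioo 0 (ν * T), ν⁻¹ * s ∈ Icc 0 T := fun s hs =>
    ⟨(hmaps hs).1.le, (hmaps hs).2.le⟩
  have hL2w : ∀ s ∈ Ioo 0 (ν * T), MemLp (w s) 2 volume := fun s hs =>
    (hLH.memLp _ (hmem_u s hs)).const_smul ν⁻¹
  set K₁ : ℝ≥0∞ := ENNReal.ofReal ν⁻¹ * eLpNorm (u 0) 2 volume with hK₁
  have hK₁top : K₁ ≠ ⊤ := ENNReal.mul_ne_top ENNReal.ofReal_ne_top hu₀2.eLpNorm_ne_top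
  have hK₁b : ∀ s ∈ Ioo 0 (ν * T), eLpNorm (w s) 2 volume ≤ K₁ := by
    intro s hs
    have h1 : w s = ν⁻¹ • u (ν⁻¹ * s) := rfl
    rw [h1, eLpNorm_const_smul, Real.enorm_eq_ofReal hν'.le, hK₁]
    gcongr
    exact hLH.eLpNorm_le_eLpNorm_datum hν.le hu₀2 (hmem_u s hs)
  set T₁ : ℝ := ν * T with hT₁
  have hT₁pos : 0 < T₁ := hνT
  -- ### Step 3: the failure of the Type-I rate (for `u`)
  have hnotIu : ∀ C : ℝ, ∀ τ₁ < T, ∃ t ∈ Ioo τ₁ T, 0 ≤ t ∧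
      ∃ x : EuclideanSpace ℝ (Fin 3), C < ‖u t x‖ ^ 2 * (T - t) := by
    intro C τ₁ hτ₁
    set Cu : ℝ := Real.sqrt (max C 0 + 1) with hCu
    have hCu0 : 0 ≤ Cu := Real.sqrt_nonneg _
    have hCusq : Cu ^ 2 = max C 0 + 1 := Real.sq_sqrt (by positivity)
    have hfreq : ∃ᶠ t in 𝓝[<] T, ∃ x, Cu / Real.sqrt (T - t) < ‖u t x‖ := by
      have h1 : ¬ ∀ᶠ t in 𝓝[<] T, ∀ x, ‖u t x‖ ≤ Cu / Real.sqrt (T - t) :=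
        fun h => hnotI ⟨Cu, h⟩
      rw [not_eventually] at h1
      refine h1.mono fun t ht => ?_
      push Not at ht
      exact ht
    have haT : max τ₁ 0 < T := max_lt hτ₁ hT
    obtain ⟨t, ⟨x, hx⟩, hta⟩ := (hfreq.and_eventually (Ioo_mem_nhdsLT haT)).exists
    have hTt : 0 < T - t := sub_pos.2 hta.2
    refine ⟨t, ⟨(le_max_left _ _).trans_lt hta.1, hta.2⟩, (le_max_right _ _).trans hta.1.le, x, ?_⟩
    have hs : 0 < Real.sqrt (T - t) := Real.sqrt_pos.2 hTt
    have h1 : Cu < ‖u t x‖ * Real.sqrt (T - t) := by rwa [div_lt_iff₀ hs] at hx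
    have h2 : Cu ^ 2 < (‖u t x‖ * Real.sqrt (T - t)) ^ 2 := pow_lt_pow_left₀ h1 hCu0 two_ne_zero
    rw [mul_pow, Real.sq_sqrt hTt.le, hCusq] at h2
    linarith [le_max_left C 0]
  -- ### Step 4: heavy doubling cells (tools) and the certified vorticity (hypothesis)
  obtain ⟨Mh, hMh⟩ := hbddu (T / 2) (by linarith)
  have hMh0 : 0 ≤ Mh := (norm_nonneg _).trans (hMh 0 ⟨le_rfl, by linarith⟩ 0)
  obtain ⟨Kc, hKc⟩ : ∃ Kc : ℕ → ℝ, ∀ j, Kc j =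
      max (max K₀ ((Mh + 1) * Real.sqrt T)) (Real.sqrt (ν * ((j : ℝ) + 2))) := ⟨_, fun _ => rfl⟩
  have hKcK₀ : ∀ j, K₀ ≤ Kc j := fun j => by rw [hKc]; exact le_max_of_le_left (le_max_left _ _)
  have hKcM : ∀ j, (Mh + 1) * Real.sqrt T ≤ Kc j := fun j => by
    rw [hKc]; exact le_max_of_le_left (le_max_right _ _)
  have hKcj : ∀ j : ℕ, ν * ((j : ℝ) + 2) ≤ Kc j ^ 2 := fun j => by
    have h1 : Real.sqrt (ν * ((j : ℝ) + 2)) ≤ Kc j := by rw [hKc]; exact le_max_right _ _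
    have h2 := pow_le_pow_left₀ (Real.sqrt_nonneg _) h1 2
    rwa [Real.sq_sqrt (by positivity)] at h2
  have hKcpos : ∀ j, 0 < Kc j := fun j => hK₀.trans_le (hKcK₀ j)
  have hcells := fun j : ℕ => exists_weighted_cell hT hbddu hnotIu (Kc j)
  choose T' t₀ x₀ hT'pos hT'T ht₀0 ht₀T' hweight hcell using hcells
  obtain ⟨M, hM⟩ : ∃ M : ℕ → ℝ, ∀ j, M j = ‖u (t₀ j) (x₀ j)‖ := ⟨_, fun _ => rfl⟩
  have hsqrt_pos : ∀ j, 0 < Real.sqrt (T' j - t₀ j) := fun j =>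
    Real.sqrt_pos.2 (sub_pos.2 (ht₀T' j))
  have hMpos : ∀ j, 0 < M j := fun j => by
    rw [hM]
    rcases (norm_nonneg (u (t₀ j) (x₀ j))).eq_or_lt with h' | h'
    · have h1 : 0 < ‖u (t₀ j) (x₀ j)‖ * Real.sqrt (T' j - t₀ j) :=
        (hKcpos j).trans_le (hweight j)
      rw [← h', zero_mul] at h1
      exact absurd h1 (lt_irrefl _)
    · exact h'
  -- the certified vorticity near the centre (the hypothesis of the item)
  have hcert := fun j => hpace (T' j) ⟨hT'pos j, hT'T j⟩ (t₀ j) ⟨ht₀0 j, ht₀T' j⟩ (x₀ j)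
    ((hKcK₀ j).trans (hweight j)) (hcell j)
  choose xs hxs hcurl using hcert
  -- `t₀ > T/2` and `M √T ≥ Kc`
  have ht₀half : ∀ j, T / 2 < t₀ j := fun j => by
    by_contra hle
    push Not at hle
    have h1 : ‖u (t₀ j) (x₀ j)‖ ≤ Mh := hMh _ ⟨ht₀0 j, hle⟩ _
    have h2 : Real.sqrt (T' j - t₀ j) ≤ Real.sqrt T :=
      Real.sqrt_le_sqrt (by linarith [hT'T j, ht₀0 j])
    have h3 : ‖u (t₀ j) (x₀ j)‖ * Real.sqrt (T' j - t₀ j) ≤ Mh * Real.sqrt T :=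
      mul_le_mul h1 h2 (Real.sqrt_nonneg _) hMh0
    have h4 : (Mh + 1) * Real.sqrt T ≤ Mh * Real.sqrt T := ((hKcM j).trans (hweight j)).trans h3
    have h5 : 0 < Real.sqrt T := Real.sqrt_pos.2 hT
    have h6 : (Mh + 1) * Real.sqrt T = Mh * Real.sqrt T + Real.sqrt T := by ring
    linarith
  have hMK : ∀ j, Kc j ≤ M j * Real.sqrt T := fun j => by
    rw [hM]
    have h2 : Real.sqrt (T' j - t₀ j) ≤ Real.sqrt T :=
      Real.sqrt_le_sqrt (by linarith [hT'T j, ht₀0 j])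
    exact (hweight j).trans (mul_le_mul_of_nonneg_left h2 (norm_nonneg _))
  have hMK2 : ∀ j, Kc j ^ 2 ≤ M j ^ 2 * T := fun j => by
    have h := pow_le_pow_left₀ (hKcpos j).le (hMK j) 2
    rwa [mul_pow, Real.sq_sqrt hT.le] at h
  -- ### Step 5: the scales and the two-sided windows
  have hs2 : 0 < Real.sqrt 2 := Real.sqrt_pos.2 two_pos
  obtain ⟨c, hc⟩ : ∃ c : ℕ → ℝ, ∀ j, c j = ν / (Real.sqrt 2 * M j) := ⟨_, fun _ => rfl⟩
  have hcpos : ∀ j, 0 < c j := fun j => by rw [hc]; exact div_pos hν (mul_pos hs2 (hMpos j))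
  have hc2 : ∀ j, c j ^ 2 = ν ^ 2 / (2 * M j ^ 2) := fun j => by
    rw [hc, div_pow, mul_pow, Real.sq_sqrt two_pos.le]
  obtain ⟨A, hA⟩ : ∃ A : ℕ → ℝ, ∀ j, A j = -(ν * t₀ j / c j ^ 2) := ⟨_, fun _ => rfl⟩
  obtain ⟨B, hB⟩ : ∃ B : ℕ → ℝ, ∀ j, B j = (T' j - t₀ j) * M j ^ 2 / ν := ⟨_, fun _ => rfl⟩
  have hA_eq : ∀ j, A j = -(2 * t₀ j * M j ^ 2 / ν) := fun j => by
    rw [hA, hc2]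
    field_simp
  have hcA : ∀ j, c j ^ 2 * A j = -(ν * t₀ j) := fun j => by
    rw [hA]
    have : c j ≠ 0 := (hcpos j).ne'
    field_simp
  have hcB : ∀ j, c j ^ 2 * B j = ν * (T' j - t₀ j) / 2 := fun j => by
    rw [hB, hc2]
    have : M j ≠ 0 := (hMpos j).ne'
    field_simp
  have hAle : ∀ j, A j ≤ -((j : ℝ) + 2) := fun j => by
    rw [hA_eq, neg_le_neg_iff, le_div_iff₀ hν]
    have h1 := hKcj j
    have h2 := hMK2 j
    have h3 : T * M j ^ 2 ≤ 2 * t₀ j * M j ^ 2 :=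
      mul_le_mul_of_nonneg_right (by linarith [ht₀half j]) (sq_nonneg _)
    nlinarith
  have hBge : ∀ j : ℕ, (j : ℝ) + 2 ≤ B j := fun j => by
    rw [hB, le_div_iff₀ hν]
    have h1 := hKcj j
    have h2 : Kc j ^ 2 ≤ (T' j - t₀ j) * M j ^ 2 := by
      have h := pow_le_pow_left₀ (hKcpos j).le (hweight j) 2
      rw [mul_pow, Real.sq_sqrt (sub_pos.2 (ht₀T' j)).le, ← hM] at h
      linarith
    linarith
  have hAB : ∀ j, A j + 2 ≤ B j := fun j => by
    have := hAle j; have := hBge j; have := j.cast_nonneg (α := ℝ); linarith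
  have hAtend : Tendsto A atTop atBot := by
    refine tendsto_atBot_mono hAle (tendsto_neg_atTop_atBot.comp ?_)
    exact tendsto_natCast_atTop_atTop.atTop_add tendsto_const_nhds
  have hBtend : Tendsto B atTop atTop :=
    tendsto_atTop_mono hBge (tendsto_natCast_atTop_atTop.atTop_add tendsto_const_nhds)
  -- the physical times of the window
  have hphys : ∀ j, ∀ s ∈ Ioo (A j) (B j),
      0 < ν * t₀ j + c j ^ 2 * s ∧ ν * t₀ j + c j ^ 2 * s < ν * ((T' j + t₀ j) / 2) := by
    intro j s hs
    have hc2p : 0 < c j ^ 2 := pow_pos (hcpos j) 2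
    have h1 : c j ^ 2 * A j < c j ^ 2 * s := mul_lt_mul_of_pos_left hs.1 hc2p
    have h2 : c j ^ 2 * s < c j ^ 2 * B j := mul_lt_mul_of_pos_left hs.2 hc2p
    rw [hcA] at h1
    rw [hcB] at h2
    constructor <;> linarith
  have hphysT : ∀ j, ∀ s ∈ Ioo (A j) (B j), ν * t₀ j + c j ^ 2 * s ∈ Ioo 0 T₁ := fun j s hs =>
    ⟨(hphys j s hs).1, (hphys j s hs).2.trans (by
      rw [hT₁]; exact mul_lt_mul_of_pos_left (by linarith [hT'T j, ht₀T' j]) hν)⟩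
  -- the rescaled solutions, centred at the certified point `xs j`
  obtain ⟨V, hV⟩ : ∃ V : ℕ → ℝ → EuclideanSpace ℝ (Fin 3) → EuclideanSpace ℝ (Fin 3),
      ∀ j, V j = c j • stPull (c j ^ 2) (c j) (ν * t₀ j) (xs j) w := ⟨_, fun _ => rfl⟩
  obtain ⟨P, hP⟩ : ∃ P : ℕ → ℝ → EuclideanSpace ℝ (Fin 3) → ℝ,
      ∀ j, P j = c j ^ 2 • stPull (c j ^ 2) (c j) (ν * t₀ j) (xs j) q := ⟨_, fun _ => rfl⟩
  have hVcl : ∀ j, IsClassicalNSSolutionOn (Ioo (A j) (B j)) 1 0 (V j) (P j) := fun j => by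
    rw [hV j, hP j]
    have hA' : A j = -(ν * t₀ j / c j ^ 2) := hA j
    exact (hclw.nsRescale_translate_zero (hcpos j) (ν * t₀ j) (xs j)).mono
      (fun s hs => hphysT j s hs) (uniqueDiffOn_Ioo _ _)
  have hVapply : ∀ j s y, V j s y = c j • w (ν * t₀ j + c j ^ 2 * s) (xs j + c j • y) :=
    fun j s y => by rw [hV j, smul_stPull_apply]
  have hVnorm : ∀ j s y,
      ‖V j s y‖ = c j * (ν⁻¹ * ‖u (ν⁻¹ * (ν * t₀ j + c j ^ 2 * s)) (xs j + c j • y)‖) :=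
    fun j s y => by rw [hVapply, norm_smul, Real.norm_eq_abs, abs_of_pos (hcpos j), hw_norm]
  -- the bound `2` on the whole window (the cell bound up to half the remaining time)
  have hVbd : ∀ j, ∀ s ∈ Ioo (A j) (B j), ∀ y, ‖V j s y‖ ≤ 2 := by
    intro j s hs y
    obtain ⟨hσ0, hσ1⟩ := hphys j s hs
    set t : ℝ := ν⁻¹ * (ν * t₀ j + c j ^ 2 * s) with htdef
    have ht0 : 0 ≤ t := by rw [htdef]; positivity
    have ht1 : t < (T' j + t₀ j) / 2 := by
      rw [htdef, inv_mul_lt_iff₀ hν]; exact hσ1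
    have htT' : t ≤ T' j := by linarith [ht₀T' j]
    have hrem : T' j - t₀ j ≤ 2 * (T' j - t) := by linarith
    have hrem0 : 0 < T' j - t := by linarith [ht₀T' j]
    have hsq : Real.sqrt (T' j - t₀ j) ≤ Real.sqrt 2 * Real.sqrt (T' j - t) := by
      rw [← Real.sqrt_mul two_pos.le]
      exact Real.sqrt_le_sqrt (by linarith)
    have hcellt := hcell j t ⟨ht0, htT'⟩ (xs j + c j • y)
    rw [← hM] at hcellt
    have hst : 0 < Real.sqrt (T' j - t) := Real.sqrt_pos.2 hrem0
    have hu : ‖u t (xs j + c j • y)‖ ≤ 2 * Real.sqrt 2 * M j := by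
      have h1 : ‖u t (xs j + c j • y)‖ * Real.sqrt (T' j - t) ≤
          2 * Real.sqrt 2 * M j * Real.sqrt (T' j - t) := by
        calc _ ≤ 2 * (M j * Real.sqrt (T' j - t₀ j)) := hcellt
          _ ≤ 2 * (M j * (Real.sqrt 2 * Real.sqrt (T' j - t))) := by
              gcongr
              exact (hMpos j).le
          _ = 2 * Real.sqrt 2 * M j * Real.sqrt (T' j - t) := by ring
      exact le_of_mul_le_mul_right h1 hst
    rw [hVnorm, ← htdef]
    have hMne : M j ≠ 0 := (hMpos j).ne'
    calc c j * (ν⁻¹ * ‖u t (xs j + c j • y)‖) ≤ c j * (ν⁻¹ * (2 * Real.sqrt 2 * M j)) :=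
          mul_le_mul_of_nonneg_left (mul_le_mul_of_nonneg_left hu hν'.le) (hcpos j).le
      _ = 2 := by rw [hc]; field_simp
  -- the certified vorticity at the apex `(0, 0)`
  have hVcurl0 : ∀ j, θ₀ / 2 ≤ ‖curl (V j 0) 0‖ := fun j => by
    have ht₀T : t₀ j ∈ Ico 0 T := ⟨ht₀0 j, (ht₀T' j).trans (hT'T j)⟩
    have hdu : Differentiable ℝ (u (t₀ j)) := (hcl.contDiff_velocity ht₀T).differentiable (by simp)
    have hslice : w (ν * t₀ j) = fun z => ν⁻¹ • u (t₀ j) z := by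
      funext z; rw [hw_apply, ← mul_assoc, inv_mul_cancel₀ hν.ne', one_mul]
    have hd : Differentiable ℝ (w (ν * t₀ j + c j ^ 2 * 0)) := by
      rw [mul_zero, add_zero, hslice]; exact hdu.const_smul ν⁻¹
    have h1 : curl (V j 0) 0 = (c j * c j) • curl (w (ν * t₀ j)) (xs j) := by
      have h := curl_zoom_slice (a := c j) (γ := c j) (x₀ := xs j) hd 0
      rw [mul_zero, add_zero, smul_zero, add_zero] at h
      rw [hV j]
      exact h
    have h2 : curl (w (ν * t₀ j)) (xs j) = ν⁻¹ • curl (u (t₀ j)) (xs j) := by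
      rw [hslice, curl_eq_curlCLM, curl_eq_curlCLM, fderiv_fun_const_smul (hdu (xs j)), map_smul]
    have hccν : 0 < c j * c j * ν⁻¹ := mul_pos (mul_pos (hcpos j) (hcpos j)) hν'
    rw [h1, h2, smul_smul, norm_smul, Real.norm_eq_abs, abs_of_pos hccν]
    have h3 := hcurl j
    rw [← hM] at h3
    -- `c² ν⁻¹ ‖curl u‖ ≥ c² ν⁻¹ θ₀ M²/ν = θ₀/2`
    have h4 : θ₀ * M j ^ 2 / ν ≤ ‖curl (u (t₀ j)) (xs j)‖ := by
      rw [div_le_iff₀ hν]; linarith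
    have h5 : c j * c j * ν⁻¹ * (θ₀ * M j ^ 2 / ν) = θ₀ / 2 := by
      rw [← sq, hc2]
      have : M j ≠ 0 := (hMpos j).ne'
      field_simp
    calc θ₀ / 2 = c j * c j * ν⁻¹ * (θ₀ * M j ^ 2 / ν) := h5.symm
      _ ≤ c j * c j * ν⁻¹ * ‖curl (u (t₀ j)) (xs j)‖ :=
          mul_le_mul_of_nonneg_left h4 hccν.le
  -- square-integrable slices, uniformly on the window
  have hVL2 : ∀ j, ∀ s ∈ Ioo (A j) (B j), MemLp (V j s) 2 volume := fun j s hs => by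
    rw [show V j s = fun y => c j • w (ν * t₀ j + c j ^ 2 * s) (xs j + c j • y) from
      funext (hVapply j s)]
    exact BoundedPlanarEnergyRegularity.memLp_two_zoom_slice (hL2w _ (hphysT j s hs)) (xs j)
      (hcpos j).ne'
  have hVK : ∀ j, ∃ K : ℝ≥0∞, K ≠ ⊤ ∧ ∀ s ∈ Ioo (A j) (B j), eLpNorm (V j s) 2 volume ≤ K := by
    intro j
    refine ⟨ENNReal.ofReal (c j) * (ENNReal.ofReal ((c j ^ 3)⁻¹) ^ (1 / (2 : ℝ≥0∞)).toReal * K₁),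
      ENNReal.mul_ne_top ENNReal.ofReal_ne_top (ENNReal.mul_ne_top
        (ENNReal.rpow_ne_top_of_nonneg (by positivity) ENNReal.ofReal_ne_top) hK₁top),
      fun s hs => ?_⟩
    rw [show V j s = fun y => c j • w (ν * t₀ j + c j ^ 2 * s) (xs j + c j • y) from
      funext (hVapply j s), BoundedPlanarEnergyRegularity.eLpNorm_two_zoom_slice _ _ (hcpos j)]
    gcongr
    exact hK₁b _ (hphysT j s hs)
  -- ### Step 6: eternal extraction (tools) and the shifted ancient extraction for the vorticity
  obtain ⟨φ, wl, hφ, hwlc, hwlbd, hwlim, hwldiv, hwlmild⟩ :=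
    exists_eternal_limit hAtend hBtend hAB hVcl hVbd hVL2 hVK
  obtain ⟨hshift, hsmooth⟩ := eternal_of_oseen hwlc hwlbd hwldiv hwlmild
  -- the windows shifted by one: `U m s = V (φ m) (s + 1)` on `(A (φ m) - 1, 0)`
  have hB2 : ∀ j, 2 ≤ B j := fun j => by have := hBge j; have := j.cast_nonneg (α := ℝ); linarith
  have hA1 : ∀ j, A j < -1 := fun j => by have := hAle j; have := j.cast_nonneg (α := ℝ); linarith
  obtain ⟨U, hU⟩ : ∃ U : ℕ → ℝ → EuclideanSpace ℝ (Fin 3) → EuclideanSpace ℝ (Fin 3),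
      ∀ m, U m = fun s => V (φ m) (s + 1) := ⟨_, fun _ => rfl⟩
  have hUmem : ∀ m, ∀ s ∈ Ioo (A (φ m) - 1) 0, s + 1 ∈ Ioo (A (φ m)) (B (φ m)) := fun m s hs =>
    ⟨by linarith [hs.1], by linarith [hs.2, hB2 (φ m)]⟩
  have hUcont : ∀ m, ContinuousOn (uncurry (U m)) (Ioo (A (φ m) - 1) 0 ×ˢ univ) := by
    intro m
    rw [hU]
    have h := ((hVcl (φ m)).comp_add_right 1).smooth_velocity.continuousOn
    exact h.mono (prod_mono (fun s hs => hUmem m s hs) Subset.rfl)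
  have hUdiv : ∀ m, ∀ s ∈ Ioo (A (φ m) - 1) 0, IsWeaklyDivFree (U m s) := fun m s hs => by
    rw [hU]
    exact VectorCalculus.IsDivFree.isWeaklyDivFree_holds ((hVcl _).divFree _ (hUmem m s hs))
      (contDiff_infty.1 ((hVcl _).contDiff_velocity (hUmem m s hs)) 1)
  have hUbd : ∀ m, ∀ s ∈ Ioo (A (φ m) - 1) 0, ∀ y, ‖U m s y‖ ≤ 2 := fun m s hs y => by
    rw [hU]; exact hVbd _ _ (hUmem m s hs) y
  have hUmild : ∀ m, ∀ s t : ℝ, A (φ m) - 1 < s → s < t → t < 0 → ∀ x,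
      U m t x = UnboundedOperators.heatExtension (U m s) (t - s) x -
        oseenDuhamel 1 s (U m) (U m) t x := by
    intro m s t hAs hst ht0 x
    obtain ⟨Kk, hKtop, hKb⟩ := hVK (φ m)
    have h := mild_of_bounded_of_eLpNorm_two_le_of_lt (hVcl (φ m)) (T := B (φ m) - 1)
      (by linarith [hAB (φ m)]) (by linarith)
      (fun r hr y => hVbd _ r ⟨hr.1, by linarith [hr.2]⟩ y) hKtop
      (fun r hr => hKb r ⟨hr.1, by linarith [hr.2]⟩) (s := s + 1) (t := t + 1)
      (by linarith) (by linarith) (by linarith [hB2 (φ m)]) x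
    rw [hU, oseenDuhamel_translate, show t - s = t + 1 - (s + 1) by ring]
    exact h
  have hAφ1 : Tendsto (fun m => A (φ m) - 1) atTop atBot :=
    tendsto_atBot_add_const_right _ (-1) (hAtend.comp hφ.tendsto_atTop)
  obtain ⟨ψ, W', hψ, -, -, -, -, -, -, hW'pt, hW'curl⟩ :=
    exists_ancientMild_limit_curl_tendsto (B := 2) hAφ1 hUcont hUdiv hUmild hUbd
  -- `W'(-1) = wl 0`
  have hW'eq : ∀ y, W' (-1) y = wl 0 y := fun y => by
    have h1 : Tendsto (fun i => U (ψ i) (-1) y) atTop (𝓝 (W' (-1) y)) := hW'pt (-1) (by norm_num) y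
    have h2 : Tendsto (fun i => U (ψ i) (-1) y) atTop (𝓝 (wl 0 y)) := by
      have h := (hwlim 0 y).comp hψ.tendsto_atTop
      refine h.congr fun i => ?_
      show V (φ (ψ i)) 0 y = U (ψ i) (-1) y
      rw [hU]
      norm_num
    exact tendsto_nhds_unique h1 h2
  have hW'fun : W' (-1) = wl 0 := funext hW'eq
  have hcurl_lim : θ₀ / 2 ≤ ‖curl (wl 0) 0‖ := by
    rw [← hW'fun]
    refine ge_of_tendsto ((hW'curl (-1) (by norm_num) 0).norm) (Eventually.of_forall fun i => ?_)
    have h : U (ψ i) (-1) = V (φ (ψ i)) 0 := by rw [hU]; norm_num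
    rw [h]
    exact hVcurl0 _
  -- ### Step 7: conclusion
  refine ⟨wl, fun τ => (hshift τ).isAncientMildSolution, ⟨2, hwlbd⟩, fun t => ?_, hsmooth, 0, ?_⟩
  · exact (hwlc.comp (continuous_const.prodMk continuous_id)).aestronglyMeasurable
  · rintro ⟨b, hb⟩
    have heq : wl 0 = fun _ => b := funext hb
    have h0 : curl (wl 0) 0 = 0 := by rw [heq, curl_eq_curlCLM]; simp
    rw [h0, norm_zero] at hcurl_lim
    linarith

end Summit.NavierStokesRegularity.NavierStokesRegularity.Theorems

end
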